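import Literature.AlgebraicGeometry.RelativeSpec.FiniteGroupQuotientGluedProperties
import Literature.AlgebraicGeometry.RelativeSpec.SymmetricPowerGlued
import Literature.AlgebraicGeometry.Motives.GaloisDescentScheme
import Literature.AlgebraicGeometry.Motives.SymmetricPowerProjective
import Literature.AlgebraicGeometry.Motives.VarietiesProperProofs
import Literature.AlgebraicGeometry.Motives.ClosedGraphMorphism
import Literature.AlgebraicGeometry.Motives.AlgPointsProperProofs
import Literature.NumberTheory.Transcendental.AnalytificationSeparatedProofs
import Literature.AlgebraicTopology.SingularHomology.FiniteQuotientInvariants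
import Literature.AlgebraicGeometry.HodgeTheory.RationalHodgeClasses
import Literature.AlgebraicGeometry.HodgeTheory.GysinFormalism
import Literature.AlgebraicGeometry.HodgeTheory.HodgeStructureOfHodgeModel
import Literature.AlgebraicGeometry.HodgeTheory.AbelJacobiPullbackHodgeSection
import Literature.AlgebraicGeometry.HodgeTheory.ComplexPointsLocallyContractible
import Mathlib.AlgebraicGeometry.Morphisms.FiniteType
import Mathlib.Topology.JacobsonSpace
import HarnessLib

/-!
# The quotient `X/G` of a `k`-scheme by a finite group of `k`-automorphisms, as a `k`-scheme, and the
# transfer `Hⁱ((X/G)(ℂ); ℂ) = Hⁱ(X(ℂ); ℂ)^G` on complex Betti cohomology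
# (Mumford, *Abelian Varieties* §7 Thm. p. 66; SGA 1, Exp. V §1; Bredon, *Sheaf Theory* II.19.2)

Topic `Literature/AlgebraicGeometry/Motives`; definition item `defn-finiteQuotient` (cell `hodge-nonav`,
route `DworkReflectionQuotients`, crux `ReflectionQuotientDescent` = stmt-HodgeConjecture-20240: HC for
the reflection-invariant classes of the Dwork sextic via the quotient fourfold `X_ψ/⟨s⟩`).

Everything scheme-theoretic is ALREADY CONSTRUCTED in the tree, for an action
`ρ : RelativeSpec.ActionOver r G` of a finite group `G` on a scheme `X` over a base (`r : X → Y`):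
`ActionOver.glued` (the gluing `X/G` of the affine quotients `Spec A_α^G` of the `G`-stable affine
opens — Mumford's proof), the quotient map `ActionOver.gluedMk` (affine, finite, surjective,
`G`-invariant, fibres = orbits), the descent `ActionOver.gluedDesc` of `G`-invariant morphisms
(categorical quotient), integrality, finite type, properness and separatedness of descended maps
(`RelativeSpec/FiniteGroupQuotient*`, `RelativeSpec/SymmetricPowerGlued`, `RelativeSpec/GeometricQuotient`).
This file is the thin PACKAGING of that construction for `k`-schemes `X : Motives.SchemeOver k`
(`= Over (Spec k)`) in the shape the Hodge routes consume, plus the layer on complex points and Betti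
cohomology:

* §1 `ActionOver.overIso ρ g : X ≅ X` (the automorphisms of an `ActionOver X.hom G` as isomorphisms
  of `k`-schemes); `Motives.finiteQuotient ρ : SchemeOver k` (`X/G → Spec k`);
  `Motives.finiteQuotient.mk ρ hcov : X ⟶ finiteQuotient ρ` — the quotient morphism `π`, under
  Mumford's hypothesis `hcov` (every point lies in a `G`-stable affine open), which holds for `X`
  projective over `k` (`ActionOver.forall_exists_stableAffineOpen_of_isProjectiveOver`, graded prime
  avoidance); `π` is `G`-invariant (`overIso_hom_mk`), surjective, FINITE (`isFinite_mk_left`), its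
  fibres are the `G`-orbits (`exists_aut_apply_eq_of_mk_apply_eq`); `X/G` is integral if `X` is,
  separated / locally of finite type / proper over `k` when `X` is; and `π` is a categorical quotient
  among `k`-morphisms to separated `k`-schemes (`finiteQuotient.desc`, `mk_desc`, `desc_unique`)
  [Mumford AV §7 Thm. p. 66 (1)(2) and Remark; SGA 1 V Prop. 1.1, Cor. 1.5, Prop. 1.8].
* §2 Complex points (`k = ℂ`): the action `pointsAction ρ g ∈ C(X(ℂ), X(ℂ))` of `G` on `X(ℂ)`
  (`= AlgPoints.mapContinuous (overIso ρ g).hom`), multiplicative (`pointsAction_one/_mul`); `π(ℂ)`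
  is `G`-invariant, SURJECTIVE (`map_mk_surjective`: complex points lift along a surjective morphism of
  `ℂ`-schemes locally of finite type — Jacobson spaces + Nullstellensatz) and its fibres are the
  `G`-orbits (`exists_pointsAction_eq_of_map_mk_eq`), so that `(X/G)(ℂ) = X(ℂ)/G` as a set.
* §3 Transfer on `complexBetti`: GIVEN the named fact
  `SingularHomology.bredon1997_quotient_cohomology_invariants` (Bredon II.19.2 / Grothendieck, Tôhoku
  V.5.3: the complex cohomology of a finite quotient of a compact Hausdorff locally contractible space is
  the invariant cohomology — the tree PROVES its free case only), for `X` proper over `ℂ` with `X(ℂ)`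
  and `(X/G)(ℂ)` locally contractible (true under projective embeddings,
  `HodgeTheory.locallyContractibleSpace_complexPoints`): `π^* : Hⁱ((X/G)(ℂ); ℂ) → Hⁱ(X(ℂ); ℂ)` is
  injective with range the `G`-invariant classes (`transfer_mk`, `complexBetti_map_mk_injective`,
  `mem_range_complexBetti_map_mk`).
* §4 Rationality and Hodge types along `π^*`: `π^*` preserves rational classes (formal); conversely a
  class `d` on `X/G` whose pull-back `π^* d` is rational is rational as soon as `X/G` is smooth
  projective (`isRationalClass_of_isRationalClass_map_mk` — universal coefficients for `X/G`,
  injectivity of `π^*`, and a `ℚ`-linear retraction of the injective `π^*_ℚ`); Hodge types are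
  preserved and detected by `π^*` when `X` and `X/G` are smooth projective (`isOfHodgeType_map_mk_iff`,
  from the tree's `IsOfHodgeType.map_of_isSmoothProjective` / `IsOfHodgeType.of_map_of_injective`).
* §5 The same with the local-contractibility hypotheses DISCHARGED for projective `X` and `X/G`
  (`X(ℂ)` is locally contractible for `X` projective — the proved semialgebraic triangulation theorem,
  `HodgeTheory.locallyContractibleSpace_complexPoints_self`): `transfer_mk_of_isProjectiveOver`,
  `mem_range_complexBetti_map_mk_iff_of_isProjectiveOver`, `existsUnique_map_mk_eq_of_isProjectiveOver`,
  `isRationalClass_map_mk_iff_of_isProjectiveOver`, `isOfHodgeType_map_mk_iff_of_isSmoothProjective`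
  and the package `exists_rational_hodge_map_mk_eq` (a `G`-invariant rational `(p, q)`-class on `X`
  is `π^* d` for a rational `(p, q)`-class `d` on `X/G`) — so the transfer fact
  `bredon1997_quotient_cohomology_invariants` is the ONLY remaining hypothesis.

NOT here (deliberately; these are the cite items wi-73354/wi-73355 of the route, to be stated ON this
interface): smoothness of `X/G` for reflection groups (Chevalley–Shephard–Todd; local half = the tree's
fact `RingTheory.RegularLocalRing.KiralyLutkebohmert2013_thm2`) and projectivity of `X/G` (norm of an
ample `G`-linearised bundle; the tree has no ample-line-bundle vocabulary on `SchemeOver`) — for the Dwork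
pencil both are Bini–Garbagnati 2012, Prop. 3.20 ("`X_ψ/⟨s⟩` is a smooth Fano fourfold"). No instance
is declared (typer lint): the `G`-action on `X(ℂ)` is the explicit family of maps `pointsAction ρ`,
assembled into a `MulAction` (`pointsMulAction`, a `def`) only locally inside proofs. Everything below is
a definition with a body or a theorem; the only named fact used is Bredon's, threaded as a hypothesis
`(hB : bredon1997_quotient_cohomology_invariants)`. No new named fact (D-0026).

Mathlib searched (pin): `Over.mk`, `Over.homMk`, `Over.isoMk`, `Over.w`, `CategoryTheory.Aut_mul_def`,
`AlgebraicGeometry.LocallyOfFiniteType.jacobsonSpace`, `nonempty_inter_closedPoints`,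
`LinearMap.exists_leftInverse_of_injective`, `LinearMap.baseChange_comp`; Mathlib has no quotients of
schemes by finite groups (the tree's `RelativeSpec` supplies them).

## References

* [MumfordAV1970] D. Mumford, *Abelian Varieties* (1970), §7, Theorem p. 66 ((1) topological quotient,
  (2) `𝒪_Y = π_*(𝒪_X)^G`; Remark: categorical quotient) and §12.
* [SGA1] A. Grothendieck, *SGA 1*, Exp. V, §1: Prop. 1.1 (`π` integral, surjective, fibres = orbits),
  Cor. 1.5 (finite type, finiteness of `π`), Prop. 1.8 (existence iff orbits lie in affine opens).
* [Bredon1997] G. E. Bredon, *Sheaf Theory*, 2nd ed., GTM 170 (1997), II Thm. 19.2 (with Thm. 19.1,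
  eq. (47), and III Thm. 1.1).
* [Grothendieck1957Tohoku] A. Grothendieck, Tôhoku Math. J. 9 (1957), Ch. V, Thm. 5.3.1 and Cor.
* [HatcherAT2002] A. Hatcher, *Algebraic Topology* (2002), §3.1 (universal coefficients, p. 198).
* [VoisinHodgeI2002] C. Voisin, *Hodge Theory and Complex Algebraic Geometry I*, §7.1.1, §7.3.2.
-/

noncomputable section

universe u

open CategoryTheory Limits AlgebraicGeometry Topology
open scoped TensorProduct
open Literature.AlgebraicGeometry.RelativeSpec

namespace Literature.AlgebraicGeometry.RelativeSpec.ActionOver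

/-! ### §1a The automorphisms of an action over `Spec k` as isomorphisms of `k`-schemes -/

section OverIso

variable {k : Type u} [Field k] {X : Literature.AlgebraicGeometry.Motives.SchemeOver k} {G : Type*}
  [Group G] (ρ : ActionOver X.hom G)

/-- The automorphism `ρ(g)` of `X`, which commutes with the structure map `X → Spec k`, as an
isomorphism of `k`-schemes `X ≅ X` in `Over (Spec k)` (Mumford AV §7: "a finite group of automorphisms
of `X`" — here of `X/k`). [cite: MumfordAV1970, §7 Thm. p. 66] -/
def overIso (g : G) : X ≅ X :=
  Over.isoMk (ρ.aut g) (ρ.aut_comp g)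

/-- The underlying morphism of schemes of `overIso ρ g` is `ρ(g)`. [cite: MumfordAV1970, §7 Thm. p. 66] -/
@[simp]
theorem overIso_hom_left (g : G) : (ρ.overIso g).hom.left = (ρ.aut g).hom := rfl

/-- `(overIso ρ 1).hom = 𝟙` (the action is a group homomorphism). [cite: MumfordAV1970, §7 Thm. p. 66] -/
theorem overIso_one_hom : (ρ.overIso 1).hom = 𝟙 X := by
  ext : 1
  rw [overIso_hom_left, map_one, Over.id_left]
  rfl

/-- `(overIso ρ (g * h)).hom = (overIso ρ h).hom ≫ (overIso ρ g).hom` (Mathlib's `Aut` multiplies by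
`f * g = g ≫ f`; the action is a group homomorphism). [cite: MumfordAV1970, §7 Thm. p. 66] -/
theorem overIso_mul_hom (g h : G) :
    (ρ.overIso (g * h)).hom = (ρ.overIso h).hom ≫ (ρ.overIso g).hom := by
  ext : 1
  rw [overIso_hom_left, map_mul, Aut.Aut_mul_def, Over.comp_left, overIso_hom_left, overIso_hom_left]
  rfl

end OverIso

/-! ### §1b Mumford's hypothesis for projective `k`-schemes: stable affine opens cover -/

section Cover

variable {k : Type u} [Field k] {X : Literature.AlgebraicGeometry.Motives.SchemeOver k} {G : Type*}
  [Group G] [Finite G] (ρ : ActionOver X.hom G)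

/-- **Every point of a projective `k`-scheme lies in a `G`-stable affine open** (Mumford's
hypothesis "the orbit of any point is contained in an affine open subset", AV §7 Thm. p. 66, is
automatic for (quasi-)projective `X`: SGA 1 V Prop. 1.8): a finite set of points of `X ⊆ ℙⁿ_k` lies
in an affine open (graded prime avoidance, the tree's `IsProjectiveOver.finiteSubsetsInAffineOpens`),
and the intersection of the translates of an affine open containing an orbit is a stable affine open
(`Motives.GaloisDescentScheme.forall_exists_stableAffineOpen`). [cite: MumfordAV1970, §7 Thm. p. 66]
[cite: SGA1, Exp. V, Prop. 1.8] -/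
theorem forall_exists_stableAffineOpen_of_isProjectiveOver
    (hX : Literature.AlgebraicGeometry.Motives.IsProjectiveOver X) (x : X.left) :
    ∃ O : ρ.StableAffineOpens, x ∈ O.1 := by
  haveI : IsProper X.hom := hX.isProper
  haveI : X.left.IsSeparated := ⟨by rw [← terminal.comp_from X.hom]; infer_instance⟩
  refine Literature.AlgebraicGeometry.Motives.GaloisDescentScheme.forall_exists_stableAffineOpen ρ
    (fun S ↦ ?_) x
  obtain ⟨W, hW, hS⟩ := hX.finiteSubsetsInAffineOpens.exists_open S
  haveI := hW
  haveI : IsAffine ((Functor.fromPUnit (Spec (.of k))).obj X.right) :=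
    inferInstanceAs (IsAffine (Spec (.of k)))
  have hWa : IsAffine (W : Scheme.{u}) := isAffine_of_isAffineHom (W.ι ≫ X.hom)
  exact ⟨W, hWa, fun y hy ↦ hS y hy⟩

end Cover

end Literature.AlgebraicGeometry.RelativeSpec.ActionOver

namespace Literature.AlgebraicGeometry.Motives

/-! ### §1c The quotient `X/G` as a `k`-scheme and the quotient morphism -/

section Quotient

variable {k : Type u} [Field k] {X : SchemeOver k} {G : Type*} [Group G] [Finite G]
  (ρ : ActionOver X.hom G) [IsSeparated X.hom]

/-- **The quotient `X/G` of a separated `k`-scheme by a finite group of `k`-automorphisms**, as a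
`k`-scheme: the tree's glued quotient `ActionOver.glued` (Mumford AV §7 Thm. p. 66; SGA 1 V §1) with
the structure map `X/G → Spec k` descended from `X → Spec k` (which is `G`-invariant by definition of
an `ActionOver X.hom G`). Meaningful under Mumford's hypothesis that the `G`-stable affine opens cover
`X` (`finiteQuotient.mk`), e.g. for `X` projective
(`ActionOver.forall_exists_stableAffineOpen_of_isProjectiveOver`). [cite: MumfordAV1970, §7 Thm. p. 66]
[cite: SGA1, Exp. V, Prop. 1.8] -/
def finiteQuotient : SchemeOver k :=
  Over.mk (ρ.gluedDesc X.hom ρ.aut_comp)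

/-- The underlying scheme of `X/G` is the glued quotient. [cite: MumfordAV1970, §7 Thm. p. 66] -/
@[simp]
theorem finiteQuotient_left : (finiteQuotient ρ).left = ρ.glued := rfl

/-- The structure map of `X/G` is the descent of `X → Spec k`. [cite: MumfordAV1970, §7 Thm. p. 66 (Remark)] -/
theorem finiteQuotient_hom : (finiteQuotient ρ).hom = ρ.gluedDesc X.hom ρ.aut_comp := rfl

variable (hcov : ∀ x : X.left, ∃ O : ρ.StableAffineOpens, x ∈ O.1)

/-- **The quotient morphism `π : X ⟶ X/G`** over `k` (Mumford's `π`; the tree's `gluedMk`).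
[cite: MumfordAV1970, §7 Thm. p. 66] -/
def finiteQuotient.mk : X ⟶ finiteQuotient ρ :=
  Over.homMk (ρ.gluedMk hcov) (ρ.gluedMk_gluedDesc hcov X.hom ρ.aut_comp)

/-- The underlying morphism of schemes of `π` is `gluedMk`. [cite: MumfordAV1970, §7 Thm. p. 66] -/
@[simp]
theorem finiteQuotient.mk_left : (finiteQuotient.mk ρ hcov).left = ρ.gluedMk hcov := rfl

/-- **`π` is `G`-invariant**: `ρ(g) ≫ π = π` (Mumford (1)). [cite: MumfordAV1970, §7 Thm. p. 66 (1)] -/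
theorem finiteQuotient.overIso_hom_mk (g : G) :
    (ρ.overIso g).hom ≫ finiteQuotient.mk ρ hcov = finiteQuotient.mk ρ hcov := by
  ext : 1
  rw [Over.comp_left, ActionOver.overIso_hom_left, finiteQuotient.mk_left]
  exact ρ.aut_hom_gluedMk hcov g

/-- `π (ρ(g) x) = π x` on points of the scheme. [cite: MumfordAV1970, §7 Thm. p. 66 (1)] -/
theorem finiteQuotient.mk_left_aut_apply (g : G) (x : X.left) :
    (finiteQuotient.mk ρ hcov).left ((ρ.aut g).hom x) = (finiteQuotient.mk ρ hcov).left x :=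
  ρ.gluedMk_aut_apply hcov g x

/-- **`π` is surjective** (Mumford (1); SGA 1 V Prop. 1.1). [cite: SGA1, Exp. V, Prop. 1.1] -/
theorem finiteQuotient.mk_left_surjective : Function.Surjective (finiteQuotient.mk ρ hcov).left :=
  ρ.gluedMk_surjective hcov

/-- **The fibres of `π` are the `G`-orbits** (Mumford (1); SGA 1 V Prop. 1.1): two points with the
same image differ by some `ρ(g)`. [cite: SGA1, Exp. V, Prop. 1.1] -/
theorem finiteQuotient.exists_aut_apply_eq_of_mk_apply_eq {x₁ x₂ : X.left}
    (h : (finiteQuotient.mk ρ hcov).left x₁ = (finiteQuotient.mk ρ hcov).left x₂) :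
    ∃ g : G, (ρ.aut g).hom x₁ = x₂ :=
  ρ.exists_aut_apply_eq_of_gluedMk_eq hcov h

/-- **`π` is finite** when `X` is locally of finite type over `k` (SGA 1 V Prop. 1.1 + Cor. 1.5:
integral and locally of finite type). [cite: SGA1, Exp. V, Prop. 1.1 and Cor. 1.5] -/
theorem finiteQuotient.isFinite_mk_left [LocallyOfFiniteType X.hom] :
    IsFinite (finiteQuotient.mk ρ hcov).left :=
  ρ.isFinite_gluedMk hcov

/-- `π` is affine (by construction, glued from `Spec A → Spec A^G`). [cite: MumfordAV1970, §7 Thm. p. 66] -/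
theorem finiteQuotient.isAffineHom_mk_left : IsAffineHom (finiteQuotient.mk ρ hcov).left :=
  inferInstanceAs (IsAffineHom (ρ.gluedMk hcov))

include hcov in
/-- **`X/G` is integral when `X` is** (SGA 1 V Prop. 1.1). [cite: SGA1, Exp. V, Prop. 1.1] -/
theorem isIntegral_finiteQuotient_left [IsIntegral X.left] : IsIntegral (finiteQuotient ρ).left :=
  ρ.isIntegral_glued hcov

include hcov in
/-- **`X/G → Spec k` is separated.** [cite: MumfordAV1970, §7 Thm. p. 66; §12] -/
theorem isSeparated_finiteQuotient_hom : IsSeparated (finiteQuotient ρ).hom :=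
  ρ.isSeparated_gluedDesc hcov X.hom ρ.aut_comp

/-- **`X/G → Spec k` is locally of finite type** when `X → Spec k` is (E. Noether: invariants of
finite type; SGA 1 V Cor. 1.5). [cite: SGA1, Exp. V, Cor. 1.5] -/
theorem locallyOfFiniteType_finiteQuotient_hom [LocallyOfFiniteType X.hom] :
    LocallyOfFiniteType (finiteQuotient ρ).hom :=
  ρ.locallyOfFiniteType_gluedDesc_base

omit [Finite G] [IsSeparated X.hom] in
/-- A `G`-invariant `k`-morphism has a `G`-invariant underlying morphism of schemes. [cite: MumfordAV1970, §7 Thm. p. 66 (Remark)] -/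
theorem finiteQuotient.aut_hom_comp_left {Z : SchemeOver k} {f : X ⟶ Z}
    (hf : ∀ g : G, (ρ.overIso g).hom ≫ f = f) (g : G) : (ρ.aut g).hom ≫ f.left = f.left := by
  have h := congrArg CommaMorphism.left (hf g)
  exact h

/-- **Universal property (existence)**: a `k`-morphism `f : X ⟶ Z` to a separated `k`-scheme which is
`G`-invariant factors through `π` (Mumford's Remark: `(Y, π)` is a categorical quotient).
[cite: MumfordAV1970, §7 Thm. p. 66 (Remark)] -/
def finiteQuotient.desc {Z : SchemeOver k} [Z.left.IsSeparated] (f : X ⟶ Z)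
    (hf : ∀ g : G, (ρ.overIso g).hom ≫ f = f) : finiteQuotient ρ ⟶ Z :=
  Over.homMk (ρ.gluedDesc f.left (finiteQuotient.aut_hom_comp_left ρ hf)) (by
    apply ρ.glued_hom_ext hcov
    change ρ.gluedMk hcov ≫ ρ.gluedDesc f.left _ ≫ Z.hom = ρ.gluedMk hcov ≫ ρ.gluedDesc X.hom ρ.aut_comp
    rw [← Category.assoc, ρ.gluedMk_gluedDesc, ρ.gluedMk_gluedDesc]
    exact Over.w f)

/-- `π ≫ desc f = f`. [cite: MumfordAV1970, §7 Thm. p. 66 (Remark)] -/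
theorem finiteQuotient.mk_desc {Z : SchemeOver k} [Z.left.IsSeparated] (f : X ⟶ Z)
    (hf : ∀ g : G, (ρ.overIso g).hom ≫ f = f) :
    finiteQuotient.mk ρ hcov ≫ finiteQuotient.desc ρ hcov f hf = f := by
  ext : 1
  exact ρ.gluedMk_gluedDesc hcov f.left _

/-- **Universal property (uniqueness)**: the factorisation through `π` is unique.
[cite: MumfordAV1970, §7 Thm. p. 66 (Remark)] -/
theorem finiteQuotient.desc_unique {Z : SchemeOver k} [Z.left.IsSeparated] (f : X ⟶ Z)
    (hf : ∀ g : G, (ρ.overIso g).hom ≫ f = f) (φ : finiteQuotient ρ ⟶ Z)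
    (hφ : finiteQuotient.mk ρ hcov ≫ φ = f) : φ = finiteQuotient.desc ρ hcov f hf := by
  have h1 : (finiteQuotient.mk ρ hcov ≫ φ).left =
      (finiteQuotient.mk ρ hcov ≫ finiteQuotient.desc ρ hcov f hf).left := by
    rw [hφ, finiteQuotient.mk_desc]
  rw [Over.comp_left, Over.comp_left, finiteQuotient.mk_left] at h1
  ext : 1
  exact ρ.glued_hom_ext hcov h1

end Quotient

section ProperQuotient

variable {k : Type u} [Field k] {X : SchemeOver k} {G : Type*} [Group G] [Finite G]
  (ρ : ActionOver X.hom G) [IsProper X.hom] (hcov : ∀ x : X.left, ∃ O : ρ.StableAffineOpens, x ∈ O.1)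

include hcov in
/-- **`X/G` is proper over `k` when `X` is** (SGA 1 V Cor. 1.5; the image of a proper scheme under
the surjective `π`). [cite: SGA1, Exp. V, Cor. 1.5] -/
theorem isProper_finiteQuotient_hom : IsProper (finiteQuotient ρ).hom :=
  ρ.isProper_gluedDesc hcov X.hom ρ.aut_comp (𝟙 _) (Category.comp_id _)

end ProperQuotient

/-! ### §2 Complex points: the action on `X(ℂ)`, `π(ℂ)` surjective with fibres the orbits -/

section Points

variable {X : SchemeOver ℂ} {G : Type} [Group G] (ρ : ActionOver X.hom G)

/-- **The action of `g ∈ G` on the complex points `X(ℂ)`**: the continuous self-map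
`P ↦ P ≫ ρ(g)` induced by the `ℂ`-automorphism `ρ(g)` (`AlgPoints.mapContinuous`).
[cite: MumfordAV1970, §7 Thm. p. 66 (1)] -/
def pointsAction (g : G) : C(ComplexPoints X, ComplexPoints X) :=
  AlgPoints.mapContinuous (L := ℂ) (ρ.overIso g).hom

/-- `pointsAction ρ g P = P ≫ ρ(g)`. [cite: MumfordAV1970, §7 Thm. p. 66 (1)] -/
theorem pointsAction_apply (g : G) (P : ComplexPoints X) :
    pointsAction ρ g P = AlgPoints.map (ρ.overIso g).hom P := rfl

/-- The underlying point of `g • P` is `ρ(g)` of the underlying point of `P`. [cite: MumfordAV1970, §7 Thm. p. 66 (1)] -/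
@[simp]
theorem pt_pointsAction (g : G) (P : ComplexPoints X) :
    (pointsAction ρ g P).pt = (ρ.aut g).hom P.pt := by
  rw [pointsAction_apply, AlgPoints.pt_map, ActionOver.overIso_hom_left]

/-- `pointsAction ρ 1 = id`. [cite: MumfordAV1970, §7 Thm. p. 66 (1)] -/
theorem pointsAction_one : pointsAction ρ 1 = ContinuousMap.id _ := by
  ext P : 1
  rw [pointsAction_apply, ActionOver.overIso_one_hom, AlgPoints.map_id_apply, ContinuousMap.id_apply]

/-- `pointsAction ρ (g * h) = pointsAction ρ g ∘ pointsAction ρ h` (a LEFT action). [cite: MumfordAV1970, §7 Thm. p. 66 (1)] -/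
theorem pointsAction_mul (g h : G) :
    pointsAction ρ (g * h) = (pointsAction ρ g).comp (pointsAction ρ h) := by
  ext P : 1
  rw [ContinuousMap.comp_apply, pointsAction_apply, pointsAction_apply, pointsAction_apply,
    ActionOver.overIso_mul_hom, AlgPoints.map_comp_apply]

/-- The maps `pointsAction ρ g` assembled into a group action of `G` on `X(ℂ)` (a `def`, used as a
local instance inside proofs only — no global instance is declared). [folklore] -/
@[reducible]
def pointsMulAction : MulAction G (ComplexPoints X) where
  smul g P := pointsAction ρ g P
  one_smul P := by
    change pointsAction ρ 1 P = P
    rw [pointsAction_one, ContinuousMap.id_apply]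
  mul_smul g h P := by
    change pointsAction ρ (g * h) P = pointsAction ρ g (pointsAction ρ h P)
    rw [pointsAction_mul, ContinuousMap.comp_apply]

/-- The action `pointsMulAction ρ` is by continuous maps (each `ρ(g)(ℂ)` is continuous for the
analytic topology). [cite: MumfordAV1970, §7 Thm. p. 66 (1)] -/
theorem continuousConstSMul_pointsMulAction :
    @ContinuousConstSMul G (ComplexPoints X) _ (pointsMulAction ρ).toSMul :=
  letI := pointsMulAction ρ
  ⟨fun g ↦ (pointsAction ρ g).continuous⟩

variable [Finite G] [IsSeparated X.hom] (hcov : ∀ x : X.left, ∃ O : ρ.StableAffineOpens, x ∈ O.1)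

/-- **`π(ℂ)` is `G`-invariant**: `π(g • P) = π(P)`. [cite: MumfordAV1970, §7 Thm. p. 66 (1)] -/
theorem map_mk_pointsAction (g : G) (P : ComplexPoints X) :
    AlgPoints.map (finiteQuotient.mk ρ hcov) (pointsAction ρ g P) =
      AlgPoints.map (finiteQuotient.mk ρ hcov) P := by
  rw [pointsAction_apply, ← AlgPoints.map_comp_apply, finiteQuotient.overIso_hom_mk]

/-- `π(ℂ) ∘ (g • –) = π(ℂ)` as continuous maps. [cite: MumfordAV1970, §7 Thm. p. 66 (1)] -/
theorem mapContinuous_mk_comp_pointsAction (g : G) :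
    (AlgPoints.mapContinuous (L := ℂ) (finiteQuotient.mk ρ hcov)).comp (pointsAction ρ g) =
      AlgPoints.mapContinuous (L := ℂ) (finiteQuotient.mk ρ hcov) :=
  ContinuousMap.ext fun P ↦ map_mk_pointsAction ρ hcov g P

/-- **The fibres of `π(ℂ)` are the `G`-orbits**: two complex points of `X` with the same image in
`(X/G)(ℂ)` differ by some `g` (the scheme-level statement `exists_aut_apply_eq_of_mk_apply_eq` plus:
a complex point of a `ℂ`-scheme locally of finite type is determined by its underlying closed point,
`AlgPoints.eq_of_pt_eq`). [cite: SGA1, Exp. V, Prop. 1.1] -/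
theorem exists_pointsAction_eq_of_map_mk_eq [LocallyOfFiniteType X.hom] {P Q : ComplexPoints X}
    (h : AlgPoints.map (finiteQuotient.mk ρ hcov) P = AlgPoints.map (finiteQuotient.mk ρ hcov) Q) :
    ∃ g : G, pointsAction ρ g P = Q := by
  have hpt : (finiteQuotient.mk ρ hcov).left P.pt = (finiteQuotient.mk ρ hcov).left Q.pt := by
    rw [← AlgPoints.pt_map, ← AlgPoints.pt_map, h]
  obtain ⟨g, hg⟩ := finiteQuotient.exists_aut_apply_eq_of_mk_apply_eq ρ hcov hpt
  exact ⟨g, AlgPoints.eq_of_pt_eq (by rw [pt_pointsAction, hg])⟩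

/-- **`π(ℂ) : X(ℂ) → (X/G)(ℂ)` is surjective** for `X` locally of finite type over `ℂ`: the
underlying point `y` of a complex point of `X/G` is closed; its (non-empty, closed) fibre in the
Jacobson space `X` contains a closed point `x` (Mathlib `nonempty_inter_closedPoints`), which carries a
complex point (Nullstellensatz, `AlgPoints.exists_pt_eq_of_isClosed_singleton`) mapping to the given
one (`AlgPoints.eq_of_pt_eq` on `X/G`, locally of finite type over `ℂ`). [cite: SGA1, Exp. V, Prop. 1.1] -/
theorem map_mk_surjective [LocallyOfFiniteType X.hom] :
    Function.Surjective (AlgPoints.map (L := ℂ) (finiteQuotient.mk ρ hcov)) := by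
  intro y
  haveI : JacobsonSpace X.left := LocallyOfFiniteType.jacobsonSpace X.hom
  haveI : LocallyOfFiniteType (finiteQuotient ρ).hom := locallyOfFiniteType_finiteQuotient_hom ρ
  set π := finiteQuotient.mk ρ hcov with hπ
  -- the fibre over the closed point `y.pt` is a non-empty closed subset of `X`
  have hyc : IsClosed ({y.pt} : Set (finiteQuotient ρ).left) := y.isClosed_singleton_pt
  have hF : IsClosed (π.left ⁻¹' {y.pt} : Set X.left) := hyc.preimage π.left.continuous
  obtain ⟨x₀, hx₀⟩ := finiteQuotient.mk_left_surjective ρ hcov y.pt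
  obtain ⟨x, hxF, hxc⟩ := nonempty_inter_closedPoints (Z := (π.left ⁻¹' {y.pt} : Set X.left))
    ⟨x₀, hx₀⟩ hF.isLocallyClosed
  obtain ⟨P, hP⟩ := AlgPoints.exists_pt_eq_of_isClosed_singleton (X := X) (K := ℂ)
    ((mem_closedPoints_iff).1 hxc)
  refine ⟨P, AlgPoints.eq_of_pt_eq ?_⟩
  rw [AlgPoints.pt_map, hP]
  exact hxF

end Points

/-! ### §3 The transfer `Hⁱ((X/G)(ℂ); ℂ) ≅ Hⁱ(X(ℂ); ℂ)^G` (from Bredon II.19.2) -/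

section Transfer

open Literature.AlgebraicTopology.SingularHomology Literature.AlgebraicGeometry.HodgeTheory

variable {X : SchemeOver ℂ} {G : Type} [Group G] [Finite G] (ρ : ActionOver X.hom G) [IsProper X.hom]
  (hcov : ∀ x : X.left, ∃ O : ρ.StableAffineOpens, x ∈ O.1)

/-- **Transfer for the finite quotient `π : X → X/G` on complex Betti cohomology** (Bredon, *Sheaf
Theory* II Thm. 19.2; Grothendieck, Tôhoku V Thm. 5.3.1), GRANTED the named fact
`bredon1997_quotient_cohomology_invariants` (finite quotients of compact Hausdorff locally contractible
spaces): for `X` proper over `ℂ` with `X(ℂ)` and `(X/G)(ℂ)` locally contractible,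
`π^* : Hⁱ((X/G)(ℂ); ℂ) → Hⁱ(X(ℂ); ℂ)` is injective and every class fixed by all `g^*`,
`g ∈ G`, is a pull-back. The hypotheses of the fact: `X(ℂ)` is compact (`X` proper,
`compactSpace_algPoints_of_isProper_holds`) and Hausdorff (`X` separated,
`ComplexPoints.t2Space_of_isSeparated`), `(X/G)(ℂ)` is Hausdorff (`X/G` separated over `ℂ`), `π(ℂ)` is
onto (`map_mk_surjective`) with fibres the orbits (`exists_pointsAction_eq_of_map_mk_eq`,
`map_mk_pointsAction`). [cite: Bredon1997, II Thm. 19.2] [cite: Grothendieck1957Tohoku, Ch. V Thm. 5.3.1] -/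
theorem transfer_mk (hB : bredon1997_quotient_cohomology_invariants)
    (hXlc : LocallyContractibleSpace (ComplexPoints X))
    (hYlc : LocallyContractibleSpace (ComplexPoints (finiteQuotient ρ))) (i : ℕ) :
    Function.Injective (complexBetti.map (finiteQuotient.mk ρ hcov) i) ∧
      ∀ c : complexBetti X i, (∀ g : G, singularCohomology.map ℂ ℂ (pointsAction ρ g) i c = c) →
        c ∈ Set.range (complexBetti.map (finiteQuotient.mk ρ hcov) i) := by
  letI : MulAction G (ComplexPoints X) := pointsMulAction ρ
  haveI : ContinuousConstSMul G (ComplexPoints X) := continuousConstSMul_pointsMulAction ρ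
  haveI : CompactSpace (ComplexPoints X) := compactSpace_algPoints_of_isProper_holds X ℂ
  haveI : T2Space (ComplexPoints X) := ComplexPoints.t2Space_of_isSeparated X
  haveI : IsSeparated (finiteQuotient ρ).hom := isSeparated_finiteQuotient_hom ρ hcov
  haveI : T2Space (ComplexPoints (finiteQuotient ρ)) :=
    ComplexPoints.t2Space_of_isSeparated (finiteQuotient ρ)
  have horb : ∀ z z' : ComplexPoints X,
      AlgPoints.mapContinuous (L := ℂ) (finiteQuotient.mk ρ hcov) z =
        AlgPoints.mapContinuous (L := ℂ) (finiteQuotient.mk ρ hcov) z' ↔ ∃ g : G, g • z = z' := by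
    intro z z'
    refine ⟨fun h ↦ exists_pointsAction_eq_of_map_mk_eq ρ hcov h, ?_⟩
    rintro ⟨g, rfl⟩
    exact (map_mk_pointsAction ρ hcov g z).symm
  obtain ⟨hinj, hsurj⟩ := hB hXlc hYlc (AlgPoints.mapContinuous (L := ℂ) (finiteQuotient.mk ρ hcov))
    (map_mk_surjective ρ hcov) horb i
  refine ⟨hinj, fun c hc ↦ hsurj c fun g ↦ ?_⟩
  have e : (⟨fun z ↦ g • z, continuous_const_smul g⟩ : C(ComplexPoints X, ComplexPoints X)) =
      pointsAction ρ g := ContinuousMap.ext fun _ ↦ rfl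
  rw [e]
  exact hc g

/-- **`π^*` is injective on `Hⁱ(–(ℂ); ℂ)`** (first half of `transfer_mk`). [cite: Bredon1997, II Thm. 19.2] -/
theorem complexBetti_map_mk_injective (hB : bredon1997_quotient_cohomology_invariants)
    (hXlc : LocallyContractibleSpace (ComplexPoints X))
    (hYlc : LocallyContractibleSpace (ComplexPoints (finiteQuotient ρ))) (i : ℕ) :
    Function.Injective (complexBetti.map (finiteQuotient.mk ρ hcov) i) :=
  (transfer_mk ρ hcov hB hXlc hYlc i).1

/-- **The range of `π^*` is the invariant cohomology `Hⁱ(X(ℂ); ℂ)^G`** (`transfer_mk` plus the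
formal inclusion `range π^* ⊆ Hⁱ(X(ℂ); ℂ)^G`). [cite: Bredon1997, II Thm. 19.2] -/
theorem mem_range_complexBetti_map_mk_iff (hB : bredon1997_quotient_cohomology_invariants)
    (hXlc : LocallyContractibleSpace (ComplexPoints X))
    (hYlc : LocallyContractibleSpace (ComplexPoints (finiteQuotient ρ))) (i : ℕ)
    (c : complexBetti X i) :
    c ∈ Set.range (complexBetti.map (finiteQuotient.mk ρ hcov) i) ↔
      ∀ g : G, singularCohomology.map ℂ ℂ (pointsAction ρ g) i c = c := by
  refine ⟨?_, (transfer_mk ρ hcov hB hXlc hYlc i).2 c⟩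
  rintro ⟨d, rfl⟩ g
  exact map_smul_map_eq_of_comp_eq _ _ (mapContinuous_mk_comp_pointsAction ρ hcov g) i d

end Transfer

/-! ### §4 Rational classes and Hodge types along `π^*` -/

section Rational

open Literature.AlgebraicTopology.SingularHomology Literature.AlgebraicGeometry.HodgeTheory

/-- **A complexified vector fixed into the rational lattice by an injective map is rational.** For an
injective `ℚ`-linear `f : V → W` and `t ∈ ℂ ⊗_ℚ V` with `(f ⊗ ℂ) t = 1 ⊗ a`, one has `t = 1 ⊗ v` for
some `v` (indeed `v = r a` for any retraction `r` of `f`) — the linear algebra of the universal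
coefficient comparison `Hⁱ(–; ℚ) ⊗ ℂ = Hⁱ(–; ℂ)`. [cite: HatcherAT2002, §3.1 p. 198] -/
theorem exists_eq_one_tmul_of_baseChange_eq_one_tmul {V W : Type*} [AddCommGroup V] [Module ℚ V]
    [AddCommGroup W] [Module ℚ W] (f : V →ₗ[ℚ] W) (hf : Function.Injective f) (t : ℂ ⊗[ℚ] V) (a : W)
    (h : f.baseChange ℂ t = (1 : ℂ) ⊗ₜ a) : ∃ v : V, t = (1 : ℂ) ⊗ₜ v := by
  obtain ⟨r, hr⟩ := LinearMap.exists_leftInverse_of_injective f (LinearMap.ker_eq_bot.2 hf)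
  refine ⟨r a, ?_⟩
  have h1 : (r.baseChange ℂ) (f.baseChange ℂ t) = t := by
    rw [← LinearMap.comp_apply, ← LinearMap.baseChange_comp, hr, LinearMap.baseChange_id,
      LinearMap.id_apply]
  rw [← h1, h, LinearMap.baseChange_tmul]

variable {X : SchemeOver ℂ} {G : Type} [Group G] [Finite G] (ρ : ActionOver X.hom G) [IsProper X.hom]
  (hcov : ∀ x : X.left, ∃ O : ρ.StableAffineOpens, x ∈ O.1)

/-- `π^*` maps rational classes to rational classes (formal: `f^*[z] = [z ∘ f_♯]`).
[cite: HatcherAT2002, §3.1 p. 198] -/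
theorem isRationalClass_map_mk {i : ℕ} {d : complexBetti (finiteQuotient ρ) i} (hd : IsRationalClass d) :
    IsRationalClass (complexBetti.map (finiteQuotient.mk ρ hcov) i d) :=
  hd.pullback _

/-- **A class on `X/G` whose pull-back to `X` is rational is rational**, when `X/G` is smooth
projective (so that `ℂ ⊗ Hⁱ((X/G)(ℂ); ℚ) → Hⁱ((X/G)(ℂ); ℂ)` is onto, universal coefficients,
`ofRatClassBaseChange_surjective`) and `π^*` is injective (Bredon): writing `d` as the complexification
`t` of rational classes, `(π^*_ℚ ⊗ ℂ) t` is the complexification of `π^* d = a ⊗ 1`, so equals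
`1 ⊗ a` by injectivity of `ℂ ⊗ Hⁱ(X(ℂ); ℚ) → Hⁱ(X(ℂ); ℂ)` (`ofRatClassBaseChange_injective`);
`π^*_ℚ` is injective (it complexifies to the injective `π^*`), so `t = 1 ⊗ v`
(`exists_eq_one_tmul_of_baseChange_eq_one_tmul`) and `d = v ⊗ 1` is rational. Together with the
transfer this gives `Hⁱ((X/G)(ℂ); ℚ) = Hⁱ(X(ℂ); ℚ)^G`. [cite: Bredon1997, II Thm. 19.2]
[cite: HatcherAT2002, §3.1 p. 198] -/
theorem isRationalClass_of_isRationalClass_map_mk (hB : bredon1997_quotient_cohomology_invariants)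
    (hXlc : LocallyContractibleSpace (ComplexPoints X))
    (hYlc : LocallyContractibleSpace (ComplexPoints (finiteQuotient ρ))) {m : ℕ}
    (hY : IsSmoothProjective m (finiteQuotient ρ)) {i : ℕ} {d : complexBetti (finiteQuotient ρ) i}
    (hd : IsRationalClass (complexBetti.map (finiteQuotient.mk ρ hcov) i d)) : IsRationalClass d := by
  set π := finiteQuotient.mk ρ hcov with hπ
  have hinj := complexBetti_map_mk_injective ρ hcov hB hXlc hYlc i
  -- `d` is the complexification of a tensor `t`
  obtain ⟨t, rfl⟩ := ofRatClassBaseChange_surjective hY i d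
  -- `π^* d = a ⊗ 1` with `a` rational
  obtain ⟨a, ha⟩ := (isRationalClass_iff_mem_range_ofRatClass _).1 hd
  -- the rational pull-back `π^*_ℚ`
  let f : singularCohomology ℚ ℚ (ComplexPoints (finiteQuotient ρ)) i →ₗ[ℚ]
      singularCohomology ℚ ℚ (ComplexPoints X) i :=
    (singularCohomology.map ℚ ℚ (AlgPoints.mapContinuous (L := ℂ) π) i).hom
  have hnat : ∀ x, ofRatClassBaseChange (ComplexPoints X) i (f.baseChange ℂ x) =
      complexBetti.map π i (ofRatClassBaseChange (ComplexPoints (finiteQuotient ρ)) i x) :=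
    fun x ↦ HodgeModel.ofRatClassBaseChange_baseChange_map π i x
  -- `π^*_ℚ` is injective: it complexifies to `π^*`, injective
  have hfinj : Function.Injective f := by
    intro v w hvw
    have h1 : complexBetti.map π i (ofRatClass _ i v) = complexBetti.map π i (ofRatClass _ i w) := by
      rw [← one_smul ℂ (ofRatClass _ i v), ← one_smul ℂ (ofRatClass _ i w),
        ← ofRatClassBaseChange_tmul, ← ofRatClassBaseChange_tmul, ← hnat, ← hnat,
        LinearMap.baseChange_tmul, LinearMap.baseChange_tmul, hvw]
    exact ofRatClass_injective i (hinj h1)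
  -- `(π^*_ℚ ⊗ ℂ) t = 1 ⊗ a`
  have hft : f.baseChange ℂ t = (1 : ℂ) ⊗ₜ a := by
    apply ofRatClassBaseChange_injective (ComplexPoints X) i
    rw [hnat, ofRatClassBaseChange_tmul, one_smul, ha]
  obtain ⟨v, rfl⟩ := exists_eq_one_tmul_of_baseChange_eq_one_tmul f hfinj t a hft
  rw [ofRatClassBaseChange_tmul, one_smul]
  exact isRationalClass_ofRatClass v

/-- **Hodge types along `π^*`**: for `X` and `X/G` smooth projective and `p + q = i`, a class `d` on
`X/G` is of type `(p, q)` iff `π^* d` is (pull-backs along morphisms of smooth projective varieties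
preserve types, `IsOfHodgeType.map_of_isSmoothProjective`; injective pull-backs detect them,
`IsOfHodgeType.of_map_of_injective`, injectivity from Bredon). [cite: VoisinHodgeI2002, §7.3.2]
[cite: Bredon1997, II Thm. 19.2] -/
theorem isOfHodgeType_map_mk_iff (hB : bredon1997_quotient_cohomology_invariants)
    (hXlc : LocallyContractibleSpace (ComplexPoints X))
    (hYlc : LocallyContractibleSpace (ComplexPoints (finiteQuotient ρ))) {n m : ℕ}
    (hX : IsSmoothProjective n X) (hY : IsSmoothProjective m (finiteQuotient ρ)) {i p q : ℕ}
    (hpq : p + q = i) (d : complexBetti (finiteQuotient ρ) i) :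
    IsOfHodgeType n X i p q (complexBetti.map (finiteQuotient.mk ρ hcov) i d) ↔
      IsOfHodgeType m (finiteQuotient ρ) i p q d :=
  ⟨fun h ↦ IsOfHodgeType.of_map_of_injective hX hY (finiteQuotient.mk ρ hcov) hpq
      (complexBetti_map_mk_injective ρ hcov hB hXlc hYlc i) h,
    fun h ↦ h.map_of_isSmoothProjective hX hY (finiteQuotient.mk ρ hcov)⟩

end Rational

/-! ### §5 The transfer for PROJECTIVE `X` and `X/G`: local contractibility discharged

`X(ℂ)` is locally contractible for every projective `ℂ`-scheme `X` — unconditionally, from the proved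
semialgebraic triangulation theorem (`HodgeTheory.locallyContractibleSpace_complexPoints_self`,
Łojasiewicz / Ohmoto–Shiota Thm. 2.2; finite polyhedra are locally contractible, Hatcher App. A.4).
So when `X` is projective and the quotient `X/G` is known to be projective (e.g. smooth projective,
the shape in which the consumers meet it) the only remaining hypothesis of §3–§4 is the transfer fact
`bredon1997_quotient_cohomology_invariants` itself. -/

section TransferProjective

open Literature.AlgebraicTopology.SingularHomology Literature.AlgebraicGeometry.HodgeTheory

variable {X : SchemeOver ℂ} {G : Type} [Group G] [Finite G] (ρ : ActionOver X.hom G) [IsProper X.hom]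
  (hcov : ∀ x : X.left, ∃ O : ρ.StableAffineOpens, x ∈ O.1)

/-- **Transfer, projective case**: for `X` projective over `ℂ` and `X/G` projective over `ℂ`,
`π^* : Hⁱ((X/G)(ℂ); ℂ) → Hⁱ(X(ℂ); ℂ)` is injective and its range is the `G`-invariant cohomology —
granted `bredon1997_quotient_cohomology_invariants`; the local-contractibility hypotheses of
`transfer_mk` are theorems (`locallyContractibleSpace_complexPoints_self_of_isProjectiveOver`).
[cite: Bredon1997, II Thm. 19.2] [cite: OhmotoShiota2017, Thm. 2.2] -/
theorem transfer_mk_of_isProjectiveOver (hB : bredon1997_quotient_cohomology_invariants)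
    (hX : IsProjectiveOver X) (hY : IsProjectiveOver (finiteQuotient ρ)) (i : ℕ) :
    Function.Injective (complexBetti.map (finiteQuotient.mk ρ hcov) i) ∧
      ∀ c : complexBetti X i, (∀ g : G, singularCohomology.map ℂ ℂ (pointsAction ρ g) i c = c) →
        c ∈ Set.range (complexBetti.map (finiteQuotient.mk ρ hcov) i) :=
  transfer_mk ρ hcov hB (locallyContractibleSpace_complexPoints_self_of_isProjectiveOver hX)
    (locallyContractibleSpace_complexPoints_self_of_isProjectiveOver hY) i

/-- `π^*` is injective, projective case. [cite: Bredon1997, II Thm. 19.2] [cite: OhmotoShiota2017, Thm. 2.2] -/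
theorem complexBetti_map_mk_injective_of_isProjectiveOver (hB : bredon1997_quotient_cohomology_invariants)
    (hX : IsProjectiveOver X) (hY : IsProjectiveOver (finiteQuotient ρ)) (i : ℕ) :
    Function.Injective (complexBetti.map (finiteQuotient.mk ρ hcov) i) :=
  (transfer_mk_of_isProjectiveOver ρ hcov hB hX hY i).1

/-- **`range π^* = Hⁱ(X(ℂ); ℂ)^G`, projective case.** [cite: Bredon1997, II Thm. 19.2]
[cite: OhmotoShiota2017, Thm. 2.2] -/
theorem mem_range_complexBetti_map_mk_iff_of_isProjectiveOver
    (hB : bredon1997_quotient_cohomology_invariants)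
    (hX : IsProjectiveOver X) (hY : IsProjectiveOver (finiteQuotient ρ)) (i : ℕ) (c : complexBetti X i) :
    c ∈ Set.range (complexBetti.map (finiteQuotient.mk ρ hcov) i) ↔
      ∀ g : G, singularCohomology.map ℂ ℂ (pointsAction ρ g) i c = c :=
  mem_range_complexBetti_map_mk_iff ρ hcov hB
    (locallyContractibleSpace_complexPoints_self_of_isProjectiveOver hX)
    (locallyContractibleSpace_complexPoints_self_of_isProjectiveOver hY) i c

/-- **An invariant class is a pull-back of a unique class**, projective case: for
`c ∈ Hⁱ(X(ℂ); ℂ)^G` there is exactly one `d ∈ Hⁱ((X/G)(ℂ); ℂ)` with `π^* d = c`.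
[cite: Bredon1997, II Thm. 19.2] [cite: OhmotoShiota2017, Thm. 2.2] -/
theorem existsUnique_map_mk_eq_of_isProjectiveOver (hB : bredon1997_quotient_cohomology_invariants)
    (hX : IsProjectiveOver X) (hY : IsProjectiveOver (finiteQuotient ρ)) {i : ℕ} {c : complexBetti X i}
    (hc : ∀ g : G, singularCohomology.map ℂ ℂ (pointsAction ρ g) i c = c) :
    ∃! d : complexBetti (finiteQuotient ρ) i, complexBetti.map (finiteQuotient.mk ρ hcov) i d = c := by
  obtain ⟨d, hd⟩ := (mem_range_complexBetti_map_mk_iff_of_isProjectiveOver ρ hcov hB hX hY i c).2 hc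
  exact ⟨d, hd, fun d' hd' ↦
    complexBetti_map_mk_injective_of_isProjectiveOver ρ hcov hB hX hY i (hd'.trans hd.symm)⟩

/-- **Rational descent, projective case**: for `X` projective and `X/G` smooth projective, a class
`d` on `X/G` is rational as soon as `π^* d` is. [cite: Bredon1997, II Thm. 19.2]
[cite: HatcherAT2002, §3.1 p. 198] -/
theorem isRationalClass_of_isRationalClass_map_mk_of_isProjectiveOver
    (hB : bredon1997_quotient_cohomology_invariants) (hX : IsProjectiveOver X) {m : ℕ}
    (hY : IsSmoothProjective m (finiteQuotient ρ)) {i : ℕ} {d : complexBetti (finiteQuotient ρ) i}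
    (hd : IsRationalClass (complexBetti.map (finiteQuotient.mk ρ hcov) i d)) : IsRationalClass d :=
  isRationalClass_of_isRationalClass_map_mk ρ hcov hB
    (locallyContractibleSpace_complexPoints_self_of_isProjectiveOver hX)
    (locallyContractibleSpace_complexPoints_self_of_isSmoothProjective hY) hY hd

/-- `IsRationalClass (π^* d) ↔ IsRationalClass d` (projective `X`, smooth projective `X/G`).
[cite: Bredon1997, II Thm. 19.2] [cite: HatcherAT2002, §3.1 p. 198] -/
theorem isRationalClass_map_mk_iff_of_isProjectiveOver
    (hB : bredon1997_quotient_cohomology_invariants) (hX : IsProjectiveOver X) {m : ℕ}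
    (hY : IsSmoothProjective m (finiteQuotient ρ)) {i : ℕ} (d : complexBetti (finiteQuotient ρ) i) :
    IsRationalClass (complexBetti.map (finiteQuotient.mk ρ hcov) i d) ↔ IsRationalClass d :=
  ⟨isRationalClass_of_isRationalClass_map_mk_of_isProjectiveOver ρ hcov hB hX hY,
    isRationalClass_map_mk ρ hcov⟩

/-- **Hodge types along `π^*`, smooth projective case**: for `X` and `X/G` smooth projective and
`p + q = i`, `π^* d` is of type `(p, q)` iff `d` is. [cite: VoisinHodgeI2002, §7.3.2]
[cite: Bredon1997, II Thm. 19.2] -/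
theorem isOfHodgeType_map_mk_iff_of_isSmoothProjective
    (hB : bredon1997_quotient_cohomology_invariants) {n m : ℕ} (hX : IsSmoothProjective n X)
    (hY : IsSmoothProjective m (finiteQuotient ρ)) {i p q : ℕ} (hpq : p + q = i)
    (d : complexBetti (finiteQuotient ρ) i) :
    IsOfHodgeType n X i p q (complexBetti.map (finiteQuotient.mk ρ hcov) i d) ↔
      IsOfHodgeType m (finiteQuotient ρ) i p q d :=
  isOfHodgeType_map_mk_iff ρ hcov hB (locallyContractibleSpace_complexPoints_self_of_isSmoothProjective hX)
    (locallyContractibleSpace_complexPoints_self_of_isSmoothProjective hY) hX hY hpq d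

/-- **The descent package used by quotient arguments** (e.g. the Dwork reflection quotients): for
`X`, `X/G` smooth projective, `p + q = i` and a RATIONAL class `c` of type `(p, q)` on `X` fixed by
`G`, there is a rational class `d` of type `(p, q)` on `X/G` with `π^* d = c` — granted the transfer
fact. [cite: Bredon1997, II Thm. 19.2] [cite: VoisinHodgeI2002, §7.3.2] -/
theorem exists_rational_hodge_map_mk_eq (hB : bredon1997_quotient_cohomology_invariants) {n m : ℕ}
    (hX : IsSmoothProjective n X) (hY : IsSmoothProjective m (finiteQuotient ρ)) {i p q : ℕ}
    (hpq : p + q = i) {c : complexBetti X i} (hcr : IsRationalClass c) (hct : IsOfHodgeType n X i p q c)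
    (hc : ∀ g : G, singularCohomology.map ℂ ℂ (pointsAction ρ g) i c = c) :
    ∃ d : complexBetti (finiteQuotient ρ) i, IsRationalClass d ∧
      IsOfHodgeType m (finiteQuotient ρ) i p q d ∧ complexBetti.map (finiteQuotient.mk ρ hcov) i d = c := by
  obtain ⟨d, hd⟩ := (mem_range_complexBetti_map_mk_iff_of_isProjectiveOver ρ hcov hB hX.isProjectiveOver
    hY.isProjectiveOver i c).2 hc
  subst hd
  exact ⟨d, isRationalClass_of_isRationalClass_map_mk_of_isProjectiveOver ρ hcov hB hX.isProjectiveOver hY hcr,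
    (isOfHodgeType_map_mk_iff_of_isSmoothProjective ρ hcov hB hX hY hpq d).1 hct, rfl⟩

end TransferProjective

end Literature.AlgebraicGeometry.Motives

end
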